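import Literature.Geometry.Kaehler.ComplexTorusKernelIdealRightOrder
import Literature.NumberTheory.ComplexMultiplication.CMTorusEquivariantIsogenies
import HarnessLib

/-!
# Composition of ideal isogenies: `φ_{B,J} ∘ φ_{A,I} = φ_{A,Iη(J)}` (Kieffer 2024 §1.4.1, Lemma 1.4.4) at torus level

For a complex torus `X = ComplexTorus Φ` (`Φ : (ι → ℝ) ≃L[ℝ] E`, `End(X) = endRingInt Φ ⊆ M_ι(ℤ)`,
`End⁰(X) = endAlgRat Φ ⊆ M_ι(ℚ)`), a left ideal `I ⊆ End(X)` with `H(I) = kernelSubgroup Φ I` finite, the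
quotient torus `B = X/H(I)` (`quotientByPeriod Φ (H I)` of `ComplexTorusQuotientFiniteSubgroup`, quotient isogeny
`φ_I = ρ(Q_I)`, `Q_I = quotientMatrix Φ (H I)`, with kernel exactly `H(I)`) and Kieffer's identification
`η = quotientEndHom Φ (H I) : End(B) ↪ End⁰(X)`, `γ ↦ Q_I⁻¹ γ Q_I` (`ComplexTorusKernelIdealRightOrder`), we
formalize, at torus level:

> "**Proposition 1.1.11** ([Mum70, Cor. 1 p. 118]). Let `A` be an abelian variety over a field `k` […]. Then
> the map `φ ↦ ker(φ)` realizes a one-to-one correspondence between: Isogenies `φ : A → B` (where `B` is another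
> abelian variety over `k`) up to postcomposition by an isomorphism `B ≃ B′`, and Finite subgroup schemes `K`
> of `A` defined over `k`. The inverse map sends `K` to the natural quotient map `A → A/K` […]."
> [Kieffer2024IsogenyGraphs, p. 10]
>
> "**Lemma 1.4.4.** Let `I` be an ideal in `End(A)`, let `B = A/H(I)`, and let `J` be an ideal in `End(B)`.
> Let `η : End(B) ↪ End⁰(A)` be the map constructed as above. Then `Iη(J)` is an ideal of `End(A)`, and the
> composite map `φ_{B,J} ∘ φ_{A,I}` is precisely `φ_{A,Iη(J)}`.
> *Proof.* We use the local-global principle: for each prime `ℓ`, we check that the overlattice of `T_ℓ(A)`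
> given by `φ_{A,I}⁻¹ ∘ φ_{B,J}⁻¹(T_ℓ(B/H_B(J)))` is the overlattice corresponding to `H_A(Iη(J))`. […]
> `= ⋂_{τ ∈ J, σ ∈ I} V_ℓ(η(τ))⁻¹ V_ℓ(σ)⁻¹(T_ℓ(A)) = ⋂_{α ∈ Iη(J)} V_ℓ(α)⁻¹(T_ℓ(A))`. This is precisely the
> overlattice of `T_ℓ(A)` corresponding to `H_A(Iη(J))` by Lemma 1.4.3." [Kieffer2024IsogenyGraphs, p. 44]
>
> "We have already seen that if `I` is principal, then `A/H(I)` is isomorphic to `A`."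
> [Kieffer2024IsogenyGraphs, p. 45]

**Torus-level proofs.** Over `ℂ`, Prop. 1.1.11 is Lange's `X/Γ` (existence: `exists_isIsogeny_ker_eq` of
`ComplexTorusQuotientFiniteSubgroup`; uniqueness: the tree's `IsIsogeny.exists_unimodular_of_ker_eq` /
`IsIsogeny.exists_addEquiv_comp_eq_of_ker_eq` / `IsIsogeny.isIsomorphic_of_ker_eq` of
`CMTorusEquivariantIsogenies` §1 — two isogenies out of `X` with the same kernel differ by an isomorphism of
complex tori under `X`), which we IMPORT and use by name.  §0 adds the twisted form needed for Prop. 1.4.6 in the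
sequel `ComplexTorusKernelIdealEquivalence` (`exists_matrix_quotientPeriod`): an invertible `M ∈ End⁰(X)` carrying
the over-lattice `A₁,ℝ⁻¹ ℤ^ι` of `Ker ρ(A₁)` onto that of `Ker ρ(A₂)` gives `R = A₂ M A₁⁻¹ ∈ GL_ι(ℤ)` with
`ℂ`-linear analytic representation `Φ ∘ M_ℝ ∘ Φ⁻¹`, i.e. `X/Ker ρ(A₁) ≅ X/Ker ρ(A₂)` (`IsIsomorphic` of
`ComplexTorusIsomorphism`, Lange §1.1.6 Ex. (5)(b)).  For Lemma 1.4.4 no local–global principle is needed: in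
the lattice coordinates of `X`, `t = π(x)` lies in `φ_I⁻¹(H_B(J))` iff `τ_ℝ Q_I x ∈ ℤ^ι` for all `τ ∈ J`, and
in `H(Iη(J))` iff `σ_ℝ (Q_I⁻¹ τ Q_I)_ℝ x ∈ ℤ^ι` for all `σ ∈ I`, `τ ∈ J`; the two agree because
`π(y) ∈ H(I) ⟺ (σ_ℝ y ∈ ℤ^ι ∀ σ ∈ I) ⟺ Q_{I,ℝ} y ∈ ℤ^ι` (`proj_mem_kernelSubgroup_iff`,
`proj_mem_iff_exists_quotientMatrix_mulVec_eq`) — the GLOBAL over-lattice `π⁻¹ H(I)` replacing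
`⋂_σ V_ℓ(σ)⁻¹ T_ℓ(A)` for all `ℓ` at once (as in Prop. 1.4.7, `ComplexTorusKernelIdealRightOrder`).  The kernel
equality then yields "precisely `φ_{A,Iη(J)}`" through Prop. 1.1.11.

## Contents (namespace `Literature.Geometry.Kaehler.ComplexTorus`)

* §0 **`exists_matrix_quotientPeriod`** / `isIsomorphic_quotientPeriod_of_endAlgRat` (an invertible
  `M ∈ End⁰(X)` matching over-lattices gives `X/Ker ρ(A₁) ≅ X/Ker ρ(A₂)` by `ρ(A₂ M A₁⁻¹)`),
  `isIsomorphic_quotientByPeriod_of_eq`, `IsIsogeny.isIsomorphic_quotientBy_ker` (`X/Ker α ≅ X`),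
  `isIsomorphic_quotientBy_kernelSubgroup_span_singleton` ("if `I` is principal, then `A/H(I)` is isomorphic to
  `A`").
* §1 `kernelSubgroup_span` (`H(span S) = ⋂_{α ∈ S} Ker α`), `exists_mem_idealOfSubgroup_coe_eq_mul_quotientEndHom`
  (`σ ∈ I`, `τ ∈ End(X/H(I))` ⟹ `σ·η(τ) ∈ End(X)`, indeed `∈ I(H(I))`: "`Iη(J)` is an ideal of `End(A)`"),
  **`idealMulEta Φ I J = Iη(J)`** (the left ideal spanned by the `σ·η(τ)`), `mem_idealMulEta_of_coe_eq`,
  `exists_mem_idealMulEta_coe_eq`, `idealMulEta_mono`, `idealMulEta_le_idealOfSubgroup` (`Iη(J) ⊆ I(H(I))`),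
  `IsKernelIdeal.idealMulEta_le` (`⊆ I` for a kernel ideal), `le_idealMulEta_top` (`I ⊆ Iη(End B)`).
* §2 LEMMA 1.4.4: `proj_mem_kernelSubgroup_idealMulEta_iff`, `proj_mulVec_quotientMatrix_mem_kernelSubgroup_iff`,
  **`kernelSubgroup_idealMulEta`** (`H(Iη(J)) = φ_I⁻¹(H_B(J))`), `kernelSubgroup_idealMulEta_top`,
  `comap_quotientBy_eq_ker` (`φ_K⁻¹(K′) = Ker(φ_{K′} ∘ φ_K)`), `isIsogeny_quotientMatrix_mul` (`φ_{K′} ∘ φ_K` is an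
  isogeny), **`kernelSubgroup_idealMulEta_eq_ker`** (`H(Iη(J)) = Ker(φ_{B,J} ∘ φ_{A,I})`), instance
  `finite_kernelSubgroup_idealMulEta`, **`exists_unimodular_quotient_idealMulEta`** /
  **`isIsomorphic_quotient_idealMulEta`** ("`φ_{B,J} ∘ φ_{A,I}` is precisely `φ_{A,Iη(J)}`": an isomorphism
  `X/H(Iη(J)) ≅ B/H_B(J)` under `X`).

No named facts are introduced (definitions with bodies and proved theorems only).

## References

* [Kieffer2024IsogenyGraphs] J. Kieffer, *Isogeny graphs in higher dimensions* (lecture notes, 2024), §1.1.2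
  Prop. 1.1.11 (p. 10); §1.4.1, the map `η` and Lemma 1.4.4 with proof (p. 44), "if `I` is principal, then
  `A/H(I)` is isomorphic to `A`" (p. 45); after W. C. Waterhouse, *Abelian varieties over finite fields*,
  Ann. Sci. ÉNS (4) 2 (1969), §3.
* [Lange2023AbelianVarietiesComplex] H. Lange, *Abelian Varieties over the Complex Numbers*, Springer 2023, §1.1.2
  ("the quotient `X/Γ` … up to isomorphisms every isogeny is of this type"), §1.1.6 Exercise (5)(b).
-/

noncomputable section

open Module Function
open scoped Matrix Manifold ContDiff

namespace Literature.Geometry.Kaehler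

namespace ComplexTorus

variable {ι : Type*} [Fintype ι] [DecidableEq ι] {E E₁ E₂ : Type*} [NormedAddCommGroup E] [NormedSpace ℂ E]
  [NormedAddCommGroup E₁] [NormedSpace ℂ E₁] [NormedAddCommGroup E₂] [NormedSpace ℂ E₂]
  (Φ : (ι → ℝ) ≃L[ℝ] E)

/-! ## Casts of integer and rational matrices (plumbing) -/

omit [Fintype ι] [DecidableEq ι] in
/-- `ℤ → ℚ → ℝ` casts of an integer matrix. [folklore] -/
private theorem map_intCast_map_ratCast (A : Matrix ι ι ℤ) :
    (A.map (Int.cast : ℤ → ℚ)).map (Rat.cast : ℚ → ℝ) = A.map (Int.cast : ℤ → ℝ) :=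
  Matrix.ext fun i j ↦ Rat.cast_intCast (A i j)

omit [DecidableEq ι] in
/-- Entrywise cast `ℚ → ℝ` of a product. [folklore] -/
private theorem map_ratCast_mul (A B : Matrix ι ι ℚ) :
    (A * B).map (Rat.cast : ℚ → ℝ) = A.map (Rat.cast : ℚ → ℝ) * B.map (Rat.cast : ℚ → ℝ) :=
  Matrix.map_mul (f := Rat.castHom ℝ)

omit [DecidableEq ι] in
/-- Entrywise cast `ℤ → ℚ` of a product. [folklore] -/
private theorem map_intCast_mul_rat (A B : Matrix ι ι ℤ) :
    (A * B).map (Int.cast : ℤ → ℚ) = A.map (Int.cast : ℤ → ℚ) * B.map (Int.cast : ℤ → ℚ) :=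
  Matrix.map_mul (f := Int.castRingHom ℚ)

omit [DecidableEq ι] in
/-- Entrywise cast `ℤ → ℝ` of a product. [folklore] -/
private theorem map_intCast_mul_real (A B : Matrix ι ι ℤ) :
    (A * B).map (Int.cast : ℤ → ℝ) = A.map (Int.cast : ℤ → ℝ) * B.map (Int.cast : ℤ → ℝ) :=
  Matrix.map_mul (f := Int.castRingHom ℝ)

omit [Fintype ι] in
/-- `1_ℝ = 1`. [folklore] -/
private theorem map_intCast_one_real : (1 : Matrix ι ι ℤ).map (Int.cast : ℤ → ℝ) = 1 :=
  Matrix.map_one _ Int.cast_zero Int.cast_one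

/-- A real matrix whose columns are integer vectors is (the real extension of) an integer matrix. [folklore] -/
private theorem exists_map_intCast_eq_of_mulVec_single {C : Matrix ι ι ℝ}
    (h : ∀ j, ∃ k : ι → ℤ, C *ᵥ Pi.single j 1 = intVec k) : ∃ R : Matrix ι ι ℤ, R.map (Int.cast : ℤ → ℝ) = C := by
  choose k hk using h
  refine ⟨Matrix.of fun i j ↦ k j i, Matrix.ext fun i j ↦ ?_⟩
  have hC : (C *ᵥ Pi.single j (1 : ℝ)) i = C i j := by
    simp
  have hij := congrFun (hk j) i
  rw [hC] at hij
  simp only [Matrix.map_apply, Matrix.of_apply, hij, intVec]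

omit [Fintype ι] [DecidableEq ι] in
/-- Two integer matrices with the same real extension are equal. [folklore] -/
private theorem eq_of_map_intCast_eq_real {R S : Matrix ι ι ℤ}
    (h : R.map (Int.cast : ℤ → ℝ) = S.map (Int.cast : ℤ → ℝ)) : R = S :=
  Matrix.map_injective (Int.cast_injective (α := ℝ)) h

/-! ## §0 Prop. 1.1.11 (uniqueness): isogenies out of `X` with the same kernel have isomorphic targets -/

section SameKernel

/-- **An invertible `M ∈ End⁰(X)` carrying the over-lattice `A₁,ℝ⁻¹(ℤ^ι)` of `X/Ker ρ(A₁)` onto the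
over-lattice `A₂,ℝ⁻¹(ℤ^ι)` of `X/Ker ρ(A₂)` induces an isomorphism `X/Ker ρ(A₁) ≅ X/Ker ρ(A₂)` under `M`**,
concretely: integer matrices `R = A₂ M A₁⁻¹`, `R⁻¹ = A₁ M⁻¹ A₂⁻¹` and the `ℂ`-linear `C = Φ ∘ M_ℝ ∘ Φ⁻¹`
with `Φ₂ ∘ R_ℝ = C ∘ Φ₁` for the quotient periods `Φᵢ = Φ ∘ Aᵢ,ℝ⁻¹` (`M = 1`: Prop. 1.1.11's "up to
postcomposition by an isomorphism `B ≃ B′`"; `M = λ`: Prop. 1.4.6 (1)).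
[cite: Kieffer2024IsogenyGraphs, §1.1.2 Prop. 1.1.11, p. 10] [cite: Lange2023AbelianVarietiesComplex, §1.1.2 ("`X/Γ = V/π⁻¹(Γ)`") and §1.1.6 Exercise (5)(b)] -/
theorem exists_matrix_quotientPeriod {A₁ A₂ : Matrix ι ι ℤ} (h₁ : A₁.det ≠ 0) (h₂ : A₂.det ≠ 0)
    {M : Matrix ι ι ℚ} (hM : M ∈ endAlgRat Φ) (hMu : IsUnit M.det)
    (hΛ : ∀ x : ι → ℝ, (∃ n : ι → ℤ, A₁.map (Int.cast : ℤ → ℝ) *ᵥ x = intVec n) ↔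
      ∃ n : ι → ℤ, A₂.map (Int.cast : ℤ → ℝ) *ᵥ (M.map (Rat.cast : ℚ → ℝ) *ᵥ x) = intVec n) :
    ∃ (R R' : Matrix ι ι ℤ) (C : E →L[ℂ] E), R' * R = 1 ∧ R * R' = 1 ∧
      (∀ y, quotientPeriod Φ A₂ h₂ (R.map (Int.cast : ℤ → ℝ) *ᵥ y) = C (quotientPeriod Φ A₁ h₁ y)) ∧
      (∀ x, C (Φ x) = Φ (M.map (Rat.cast : ℚ → ℝ) *ᵥ x)) ∧
      R.map (Int.cast : ℤ → ℚ) * A₁.map (Int.cast : ℤ → ℚ) = A₂.map (Int.cast : ℤ → ℚ) * M := by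
  have hu1 : IsUnit (A₁.map (Int.cast : ℤ → ℝ)).det := isUnit_det_map_intCast A₁ h₁
  have hu2 : IsUnit (A₂.map (Int.cast : ℤ → ℝ)).det := isUnit_det_map_intCast A₂ h₂
  have hMinv : M.map (Rat.cast : ℚ → ℝ) * (M⁻¹).map (Rat.cast : ℚ → ℝ) = 1 := by
    rw [← map_ratCast_mul, Matrix.mul_nonsing_inv _ hMu, Matrix.map_one Rat.cast Rat.cast_zero Rat.cast_one]
  have huM : IsUnit (M.map (Rat.cast : ℚ → ℝ)).det := Matrix.isUnit_det_of_right_inverse hMinv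
  have hsingle : ∀ j : ι, (Pi.single j (1 : ℝ) : ι → ℝ) = intVec (Pi.single j (1 : ℤ)) := fun j ↦
    (intVec_single j).symm
  -- `R = A₂ M A₁⁻¹` is integral: `A₁ x ∈ ℤ^ι ⟹ A₂ M x ∈ ℤ^ι`
  obtain ⟨R, hR⟩ : ∃ R : Matrix ι ι ℤ, R.map (Int.cast : ℤ → ℝ) =
      A₂.map (Int.cast : ℤ → ℝ) * M.map (Rat.cast : ℚ → ℝ) * (A₁.map (Int.cast : ℤ → ℝ))⁻¹ := by
    refine exists_map_intCast_eq_of_mulVec_single fun j ↦ ?_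
    have hx : ∃ n : ι → ℤ, A₁.map (Int.cast : ℤ → ℝ) *ᵥ ((A₁.map (Int.cast : ℤ → ℝ))⁻¹ *ᵥ Pi.single j (1 : ℝ)) =
        intVec n :=
      ⟨Pi.single j 1, by rw [Matrix.mulVec_mulVec, Matrix.mul_nonsing_inv _ hu1, Matrix.one_mulVec, hsingle]⟩
    obtain ⟨n, hn⟩ := (hΛ _).1 hx
    exact ⟨n, by rw [← Matrix.mulVec_mulVec, ← Matrix.mulVec_mulVec, hn]⟩
  -- `R' = A₁ M⁻¹ A₂⁻¹` is integral: `A₂ M x ∈ ℤ^ι ⟹ A₁ x ∈ ℤ^ι`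
  obtain ⟨R', hR'⟩ : ∃ R' : Matrix ι ι ℤ, R'.map (Int.cast : ℤ → ℝ) =
      A₁.map (Int.cast : ℤ → ℝ) * (M.map (Rat.cast : ℚ → ℝ))⁻¹ * (A₂.map (Int.cast : ℤ → ℝ))⁻¹ := by
    refine exists_map_intCast_eq_of_mulVec_single fun j ↦ ?_
    have hx : ∃ n : ι → ℤ, A₂.map (Int.cast : ℤ → ℝ) *ᵥ (M.map (Rat.cast : ℚ → ℝ) *ᵥ
        ((M.map (Rat.cast : ℚ → ℝ))⁻¹ *ᵥ ((A₂.map (Int.cast : ℤ → ℝ))⁻¹ *ᵥ Pi.single j (1 : ℝ)))) = intVec n :=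
      ⟨Pi.single j 1, by
        simp only [Matrix.mulVec_mulVec]
        rw [Matrix.mul_nonsing_inv_cancel_left _ _ huM, Matrix.mul_nonsing_inv _ hu2, Matrix.one_mulVec,
          hsingle]⟩
    obtain ⟨n, hn⟩ := (hΛ _).2 hx
    exact ⟨n, by rw [← Matrix.mulVec_mulVec, ← Matrix.mulVec_mulVec, hn]⟩
  have hR'R : R' * R = 1 := eq_of_map_intCast_eq_real (by
    rw [map_intCast_mul_real, hR, hR', map_intCast_one_real]
    calc A₁.map (Int.cast : ℤ → ℝ) * (M.map (Rat.cast : ℚ → ℝ))⁻¹ * (A₂.map (Int.cast : ℤ → ℝ))⁻¹ *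
          (A₂.map (Int.cast : ℤ → ℝ) * M.map (Rat.cast : ℚ → ℝ) * (A₁.map (Int.cast : ℤ → ℝ))⁻¹)
        = A₁.map (Int.cast : ℤ → ℝ) * ((M.map (Rat.cast : ℚ → ℝ))⁻¹ * ((A₂.map (Int.cast : ℤ → ℝ))⁻¹ *
            (A₂.map (Int.cast : ℤ → ℝ) * (M.map (Rat.cast : ℚ → ℝ) * (A₁.map (Int.cast : ℤ → ℝ))⁻¹)))) := by
          simp only [Matrix.mul_assoc]
      _ = 1 := by
          rw [Matrix.nonsing_inv_mul_cancel_left _ _ hu2, Matrix.nonsing_inv_mul_cancel_left _ _ huM,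
            Matrix.mul_nonsing_inv _ hu1])
  have hRR' : R * R' = 1 := eq_of_map_intCast_eq_real (by
    rw [map_intCast_mul_real, hR, hR', map_intCast_one_real]
    calc A₂.map (Int.cast : ℤ → ℝ) * M.map (Rat.cast : ℚ → ℝ) * (A₁.map (Int.cast : ℤ → ℝ))⁻¹ *
          (A₁.map (Int.cast : ℤ → ℝ) * (M.map (Rat.cast : ℚ → ℝ))⁻¹ * (A₂.map (Int.cast : ℤ → ℝ))⁻¹)
        = A₂.map (Int.cast : ℤ → ℝ) * (M.map (Rat.cast : ℚ → ℝ) * ((A₁.map (Int.cast : ℤ → ℝ))⁻¹ *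
            (A₁.map (Int.cast : ℤ → ℝ) * ((M.map (Rat.cast : ℚ → ℝ))⁻¹ * (A₂.map (Int.cast : ℤ → ℝ))⁻¹)))) := by
          simp only [Matrix.mul_assoc]
      _ = 1 := by
          rw [Matrix.nonsing_inv_mul_cancel_left _ _ hu1, Matrix.mul_nonsing_inv_cancel_left _ _ huM,
            Matrix.mul_nonsing_inv _ hu2])
  -- the analytic representation `C = Φ ∘ M_ℝ ∘ Φ⁻¹`, `ℂ`-linear because `M ∈ End⁰(X)` commutes with `J_Φ`
  obtain ⟨F, hF⟩ : ∃ F : E →L[ℝ] E, ∀ x, F (Φ x) = Φ (M.map (Rat.cast : ℚ → ℝ) *ᵥ x) :=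
    ⟨(Φ : (ι → ℝ) →L[ℝ] E).comp ((LinearMap.toContinuousLinearMap
      (Matrix.mulVecLin (M.map (Rat.cast : ℚ → ℝ)))).comp (Φ.symm : E →L[ℝ] (ι → ℝ))), fun x ↦ by simp⟩
  have hI : ∀ u, F (Complex.I • u) = Complex.I • F u := fun u ↦ by
    obtain ⟨x, rfl⟩ := Φ.surjective u
    rw [← apply_latticeJ, hF, hF, (mem_endAlgRat_iff_mulVec Φ M).1 hM x, apply_latticeJ]
  refine ⟨R, R', toComplexLinear F hI, hR'R, hRR', fun y ↦ ?_, fun x ↦ by rw [toComplexLinear_apply, hF], ?_⟩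
  · -- `Φ₂ (R_ℝ y) = Φ₂ (A₂ (M (A₁⁻¹ y))) = Φ (M (A₁⁻¹ y)) = C (Φ (A₁⁻¹ y)) = C (Φ₁ y)`
    have hy : quotientPeriod Φ A₁ h₁ y = Φ ((A₁.map (Int.cast : ℤ → ℝ))⁻¹ *ᵥ y) := by
      have h := quotientPeriod_mulVec Φ A₁ h₁ ((A₁.map (Int.cast : ℤ → ℝ))⁻¹ *ᵥ y)
      rwa [Matrix.mulVec_mulVec, Matrix.mul_nonsing_inv _ hu1, Matrix.one_mulVec] at h
    rw [hy, toComplexLinear_apply, hF, hR, ← Matrix.mulVec_mulVec, ← Matrix.mulVec_mulVec, quotientPeriod_mulVec]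
  · apply Matrix.map_injective (Rat.cast_injective (α := ℝ))
    change (R.map (Int.cast : ℤ → ℚ) * A₁.map (Int.cast : ℤ → ℚ)).map (Rat.cast : ℚ → ℝ) =
      (A₂.map (Int.cast : ℤ → ℚ) * M).map (Rat.cast : ℚ → ℝ)
    rw [map_ratCast_mul, map_ratCast_mul, map_intCast_map_ratCast, map_intCast_map_ratCast,
      map_intCast_map_ratCast, hR, Matrix.mul_assoc, Matrix.nonsing_inv_mul _ hu1, Matrix.mul_one]

/-- `X/Ker ρ(A₁) ≅ X/Ker ρ(A₂)` whenever an invertible `M ∈ End⁰(X)` carries the over-lattice of the first onto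
that of the second. [cite: Kieffer2024IsogenyGraphs, §1.1.2 Prop. 1.1.11, p. 10] [cite: Lange2023AbelianVarietiesComplex, §1.1.6 Exercise (5)(b)] -/
theorem isIsomorphic_quotientPeriod_of_endAlgRat {A₁ A₂ : Matrix ι ι ℤ} (h₁ : A₁.det ≠ 0) (h₂ : A₂.det ≠ 0)
    {M : Matrix ι ι ℚ} (hM : M ∈ endAlgRat Φ) (hMu : IsUnit M.det)
    (hΛ : ∀ x : ι → ℝ, (∃ n : ι → ℤ, A₁.map (Int.cast : ℤ → ℝ) *ᵥ x = intVec n) ↔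
      ∃ n : ι → ℤ, A₂.map (Int.cast : ℤ → ℝ) *ᵥ (M.map (Rat.cast : ℚ → ℝ) *ᵥ x) = intVec n) :
    IsIsomorphic (quotientPeriod Φ A₁ h₁) (quotientPeriod Φ A₂ h₂) := by
  obtain ⟨R, R', C, hR'R, hRR', hC, -, -⟩ := exists_matrix_quotientPeriod Φ h₁ h₂ hM hMu hΛ
  exact isIsomorphic_of_matrix hR'R hRR' C hC

/-- Equal finite subgroups give isomorphic (indeed identical) quotient tori.
[cite: Kieffer2024IsogenyGraphs, §1.1.2 Prop. 1.1.11, p. 10] -/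
theorem isIsomorphic_quotientByPeriod_of_eq {K₁ K₂ : AddSubgroup (ComplexTorus Φ)} [Finite K₁] [Finite K₂]
    (h : K₁ = K₂) : IsIsomorphic (quotientByPeriod Φ K₁) (quotientByPeriod Φ K₂) := by
  subst h
  exact IsIsomorphic.refl _

variable {Φ} in
/-- **`X/Ker α ≅ X` for an isogeny `α : X → X`** (both `φ_{Ker α} : X → X/Ker α` and `α : X → X` are isogenies
out of `X` with kernel `Ker α`). [cite: Kieffer2024IsogenyGraphs, §1.1.2 Prop. 1.1.11 (p. 10) and §1.4.1 ("if `I` is principal, then `A/H(I)` is isomorphic to `A`", p. 45)] -/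
theorem IsIsogeny.isIsomorphic_quotientBy_ker {α : Matrix ι ι ℤ} (hα : IsIsogeny Φ Φ α)
    [Finite (mapMatrixHom Φ Φ α).ker] : IsIsomorphic (quotientByPeriod Φ (mapMatrixHom Φ Φ α).ker) Φ :=
  (isIsogeny_quotientBy Φ _).isIsomorphic_of_ker_eq hα (ker_mapMatrixHom_quotientBy Φ _)

variable {Φ} in
/-- **"if `I` is principal, then `A/H(I)` is isomorphic to `A`"**: `X/H(End(X)·α) = X/Ker α ≅ X` for an
isogeny `α ∈ End(X)`. [cite: Kieffer2024IsogenyGraphs, §1.4.1 (after Def. 1.4.1 and before Lemma 1.4.5), pp. 43, 45] -/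
theorem isIsomorphic_quotientBy_kernelSubgroup_span_singleton {α : endRingInt Φ}
    (hα : IsIsogeny Φ Φ (α : Matrix ι ι ℤ)) [Finite (kernelSubgroup Φ (Ideal.span {α}))] :
    IsIsomorphic (quotientByPeriod Φ (kernelSubgroup Φ (Ideal.span {α}))) Φ := by
  haveI : Finite (mapMatrixHom Φ Φ (α : Matrix ι ι ℤ)).ker := hα.finite_ker
  exact (isIsomorphic_quotientByPeriod_of_eq Φ (kernelSubgroup_span_singleton Φ α)).trans
    hα.isIsomorphic_quotientBy_ker

end SameKernel

/-! ## §1 The ideal `Iη(J)` of `End(X)` -/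

section IdealMulEta

/-- **`H(span S) = ⋂_{α ∈ S} Ker α`**: the kernel subgroup of the left ideal generated by a set `S ⊆ End(X)` is cut
out by the generators (`I(K)` is an ideal, so `S ⊆ I(K) ⟺ span S ⊆ I(K)`).
[cite: Kieffer2024IsogenyGraphs, §1.4.1 Def. 1.4.1 and Lemma 1.4.4 (proof: "`⋂_{τ ∈ J, σ ∈ I} … = ⋂_{α ∈ Iη(J)} …`"), pp. 43–44] -/
theorem kernelSubgroup_span (S : Set (endRingInt Φ)) :
    kernelSubgroup Φ (Ideal.span S) = ⨅ α ∈ S, (mapMatrixHom Φ Φ (α : Matrix ι ι ℤ)).ker := by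
  refine le_antisymm (le_iInf₂ fun α hα ↦ kernelSubgroup_le_ker Φ (Ideal.subset_span hα)) ?_
  rw [← le_idealOfSubgroup_iff_le_kernelSubgroup Φ, Ideal.span_le]
  intro α hα
  exact (mem_idealOfSubgroup_iff Φ).2 (iInf₂_le α hα)

variable (I : Ideal (endRingInt Φ)) [Finite (kernelSubgroup Φ I)]

/-- **"`Iη(J)` is an ideal of `End(A)`"**, generatorwise: for `σ ∈ I` and `τ ∈ End(X/H(I))` the rational matrix
`σ · η(τ)` is (the image of) an element of `End(X)` — indeed of `I(H(I))`: it maps `ℤ^ι ⊆ π⁻¹H(I)` into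
`σ(π⁻¹H(I)) ⊆ ℤ^ι`, commutes with `J_Φ`, and kills `H(I)` (the inclusion "`⊆`" of Prop. 1.4.7,
`range_quotientEndHom_le_rightOrder`, applied to `σ ∈ I ⊆ I(H(I))`).
[cite: Kieffer2024IsogenyGraphs, §1.4.1 Lemma 1.4.4, p. 44] -/
theorem exists_mem_idealOfSubgroup_coe_eq_mul_quotientEndHom {σ : endRingInt Φ} (hσ : σ ∈ I)
    (τ : endRingInt (quotientByPeriod Φ (kernelSubgroup Φ I))) :
    ∃ α ∈ idealOfSubgroup Φ (kernelSubgroup Φ I), (α : Matrix ι ι ℤ).map (Int.cast : ℤ → ℚ) =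
      (σ : Matrix ι ι ℤ).map (Int.cast : ℤ → ℚ) * quotientEndHom Φ (kernelSubgroup Φ I) τ :=
  ((mem_rightOrder_iff Φ).1 (range_quotientEndHom_le_rightOrder Φ (kernelSubgroup Φ I) ⟨τ, rfl⟩)).2 σ
    (le_idealOfSubgroup_kernelSubgroup Φ I hσ)

/-- **`Iη(J)`**: for a left ideal `I ⊆ End(X)` with `H(I)` finite, `B = X/H(I)`, Kieffer's
`η : End(B) ↪ End⁰(X)` (`quotientEndHom`) and a left ideal `J ⊆ End(B)`, the left ideal of `End(X)` spanned by
the products `σ · η(τ)`, `σ ∈ I`, `τ ∈ J` (each of which lies in `End(X)`,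
`exists_mem_idealOfSubgroup_coe_eq_mul_quotientEndHom`; the left `End(X)`-span of these products is their
additive span, `β(ση(τ)) = (βσ)η(τ)`). [cite: Kieffer2024IsogenyGraphs, §1.4.1 Lemma 1.4.4 ("Then `Iη(J)` is an ideal of `End(A)`"), p. 44] -/
def idealMulEta (J : Ideal (endRingInt (quotientByPeriod Φ (kernelSubgroup Φ I)))) : Ideal (endRingInt Φ) :=
  Ideal.span {α | ∃ σ ∈ I, ∃ τ ∈ J, (α : Matrix ι ι ℤ).map (Int.cast : ℤ → ℚ) =
    (σ : Matrix ι ι ℤ).map (Int.cast : ℤ → ℚ) * quotientEndHom Φ (kernelSubgroup Φ I) τ}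

variable (J : Ideal (endRingInt (quotientByPeriod Φ (kernelSubgroup Φ I))))

/-- The generators `σ · η(τ)` lie in `Iη(J)`. [cite: Kieffer2024IsogenyGraphs, §1.4.1 Lemma 1.4.4, p. 44] -/
theorem mem_idealMulEta_of_coe_eq {α σ : endRingInt Φ} (hσ : σ ∈ I)
    {τ : endRingInt (quotientByPeriod Φ (kernelSubgroup Φ I))} (hτ : τ ∈ J)
    (h : (α : Matrix ι ι ℤ).map (Int.cast : ℤ → ℚ) =
      (σ : Matrix ι ι ℤ).map (Int.cast : ℤ → ℚ) * quotientEndHom Φ (kernelSubgroup Φ I) τ) :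
    α ∈ idealMulEta Φ I J :=
  Ideal.subset_span ⟨σ, hσ, τ, hτ, h⟩

/-- Every product `σ · η(τ)` (`σ ∈ I`, `τ ∈ J`) is the image of an element of `Iη(J)`.
[cite: Kieffer2024IsogenyGraphs, §1.4.1 Lemma 1.4.4, p. 44] -/
theorem exists_mem_idealMulEta_coe_eq {σ : endRingInt Φ} (hσ : σ ∈ I)
    {τ : endRingInt (quotientByPeriod Φ (kernelSubgroup Φ I))} (hτ : τ ∈ J) :
    ∃ α ∈ idealMulEta Φ I J, (α : Matrix ι ι ℤ).map (Int.cast : ℤ → ℚ) =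
      (σ : Matrix ι ι ℤ).map (Int.cast : ℤ → ℚ) * quotientEndHom Φ (kernelSubgroup Φ I) τ := by
  obtain ⟨α, -, hα⟩ := exists_mem_idealOfSubgroup_coe_eq_mul_quotientEndHom Φ I hσ τ
  exact ⟨α, mem_idealMulEta_of_coe_eq Φ I J hσ hτ hα, hα⟩

/-- `J ↦ Iη(J)` is monotone. [cite: Kieffer2024IsogenyGraphs, §1.4.1 Lemma 1.4.4, p. 44] -/
theorem idealMulEta_mono {J J' : Ideal (endRingInt (quotientByPeriod Φ (kernelSubgroup Φ I)))} (h : J ≤ J') :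
    idealMulEta Φ I J ≤ idealMulEta Φ I J' :=
  Ideal.span_mono fun _ ⟨σ, hσ, τ, hτ, hα⟩ ↦ ⟨σ, hσ, τ, h hτ, hα⟩

/-- **`Iη(J) ⊆ I(H(I))`**: every element of `Iη(J)` kills `H(I)`. [cite: Kieffer2024IsogenyGraphs, §1.4.1 Lemma 1.4.4, p. 44] -/
theorem idealMulEta_le_idealOfSubgroup : idealMulEta Φ I J ≤ idealOfSubgroup Φ (kernelSubgroup Φ I) := by
  refine Ideal.span_le.2 ?_
  rintro α ⟨σ, hσ, τ, -, hα⟩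
  obtain ⟨α', hα', hα'e⟩ := exists_mem_idealOfSubgroup_coe_eq_mul_quotientEndHom Φ I hσ τ
  rw [← hα'e] at hα
  rwa [Subtype.ext (Matrix.map_injective (Int.cast_injective (α := ℚ)) hα)]

variable {I} in
/-- For a KERNEL ideal `I`: `Iη(J) ⊆ I`. [cite: Kieffer2024IsogenyGraphs, §1.4.1 Def. 1.4.2 and Lemma 1.4.4, pp. 43–44] -/
theorem IsKernelIdeal.idealMulEta_le (hI : IsKernelIdeal Φ I) : idealMulEta Φ I J ≤ I :=
  (idealMulEta_le_idealOfSubgroup Φ I J).trans hI.le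

/-- `I ⊆ Iη(End(B))` (`τ = 1`, `η(1) = 1`). [cite: Kieffer2024IsogenyGraphs, §1.4.1 Lemma 1.4.4, p. 44] -/
theorem le_idealMulEta_top : I ≤ idealMulEta Φ I ⊤ := fun σ hσ ↦
  mem_idealMulEta_of_coe_eq Φ I ⊤ hσ Submodule.mem_top (τ := 1) (by rw [map_one, Matrix.mul_one])

end IdealMulEta

/-! ## §2 Lemma 1.4.4: `φ_{B,J} ∘ φ_{A,I}` is precisely `φ_{A,Iη(J)}` -/

section Lemma144

variable (I : Ideal (endRingInt Φ)) [Finite (kernelSubgroup Φ I)]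
  (J : Ideal (endRingInt (quotientByPeriod Φ (kernelSubgroup Φ I))))

omit [DecidableEq ι] in
/-- A product relation `α_ℚ = σ_ℚ M` read over `ℝ`. [folklore] -/
private theorem map_intCast_eq_mul_map_ratCast {α σ : Matrix ι ι ℤ} {M : Matrix ι ι ℚ}
    (h : α.map (Int.cast : ℤ → ℚ) = σ.map (Int.cast : ℤ → ℚ) * M) :
    α.map (Int.cast : ℤ → ℝ) = σ.map (Int.cast : ℤ → ℝ) * M.map (Rat.cast : ℚ → ℝ) := by
  have h' := congrArg (fun N : Matrix ι ι ℚ ↦ N.map (Rat.cast : ℚ → ℝ)) h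
  simpa only [map_ratCast_mul, map_intCast_map_ratCast] using h'

/-- **`π(x) ∈ H(Iη(J)) ⟺ σ_ℝ η(τ)_ℝ x ∈ ℤ^ι` for all `σ ∈ I`, `τ ∈ J`** (the generators cut out `H`, and
`(σ η(τ))_ℝ = σ_ℝ η(τ)_ℝ`). [cite: Kieffer2024IsogenyGraphs, §1.4.1 Lemma 1.4.4 (proof: "`= ⋂_{τ ∈ J, σ ∈ I} V_ℓ(η(τ))⁻¹ V_ℓ(σ)⁻¹(T_ℓ(A))`"), p. 44] -/
theorem proj_mem_kernelSubgroup_idealMulEta_iff (x : ι → ℝ) :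
    proj Φ x ∈ kernelSubgroup Φ (idealMulEta Φ I J) ↔
      ∀ σ ∈ I, ∀ τ ∈ J, ∃ n : ι → ℤ, (σ : Matrix ι ι ℤ).map (Int.cast : ℤ → ℝ) *ᵥ
        ((quotientEndHom Φ (kernelSubgroup Φ I) τ).map (Rat.cast : ℚ → ℝ) *ᵥ x) = intVec n := by
  rw [idealMulEta, kernelSubgroup_span]
  simp only [AddSubgroup.mem_iInf, Set.mem_setOf_eq]
  constructor
  · intro h σ hσ τ hτ
    obtain ⟨α, -, hα⟩ := exists_mem_idealOfSubgroup_coe_eq_mul_quotientEndHom Φ I hσ τ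
    obtain ⟨n, hn⟩ := (proj_mem_ker_mapMatrixHom_iff Φ Φ _ x).1 (h α ⟨σ, hσ, τ, hτ, hα⟩)
    exact ⟨n, by rw [Matrix.mulVec_mulVec, ← map_intCast_eq_mul_map_ratCast hα, hn]⟩
  · rintro h α ⟨σ, hσ, τ, hτ, hα⟩
    obtain ⟨n, hn⟩ := h σ hσ τ hτ
    exact (proj_mem_ker_mapMatrixHom_iff Φ Φ _ x).2 ⟨n, by rw [map_intCast_eq_mul_map_ratCast hα,
      ← Matrix.mulVec_mulVec, hn]⟩

/-- **`φ_I(π(x)) ∈ H_B(J) ⟺ σ_ℝ η(τ)_ℝ x ∈ ℤ^ι` for all `σ ∈ I`, `τ ∈ J`**: `φ_I(π x) = π_B(Q_I x)` lies in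
`H_B(J)` iff `τ_ℝ Q_I x ∈ ℤ^ι` for all `τ ∈ J`, and `Q_I (η(τ)_ℝ x) = τ_ℝ (Q_I x)` is a lattice vector iff
`π(η(τ)_ℝ x) ∈ H(I)` iff every `σ ∈ I` sends `η(τ)_ℝ x` into `ℤ^ι` — the global form of
"`V_ℓ(φ_{A,I})⁻¹ ∘ V_ℓ(τ)⁻¹(T_ℓ(B)) = V_ℓ(η(τ))⁻¹ V_ℓ(φ_{A,I}⁻¹(T_ℓ(B))) = ⋂_{σ∈I} V_ℓ(η(τ))⁻¹ V_ℓ(σ)⁻¹(T_ℓ(A))`".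
[cite: Kieffer2024IsogenyGraphs, §1.4.1 Lemma 1.4.4 (proof), p. 44] -/
theorem proj_mulVec_quotientMatrix_mem_kernelSubgroup_iff (x : ι → ℝ) :
    proj (quotientByPeriod Φ (kernelSubgroup Φ I))
        ((quotientMatrix Φ (kernelSubgroup Φ I)).map (Int.cast : ℤ → ℝ) *ᵥ x) ∈
      kernelSubgroup (quotientByPeriod Φ (kernelSubgroup Φ I)) J ↔
      ∀ σ ∈ I, ∀ τ ∈ J, ∃ n : ι → ℤ, (σ : Matrix ι ι ℤ).map (Int.cast : ℤ → ℝ) *ᵥ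
        ((quotientEndHom Φ (kernelSubgroup Φ I) τ).map (Rat.cast : ℚ → ℝ) *ᵥ x) = intVec n := by
  rw [proj_mem_kernelSubgroup_iff]
  refine ⟨fun h σ hσ τ hτ ↦ ?_, fun h τ hτ ↦ ?_⟩
  · -- `Q_I (η(τ) x) = τ (Q_I x) ∈ ℤ^ι`, so `π(η(τ) x) ∈ H(I)` and `σ` sends it into `ℤ^ι`
    obtain ⟨n, hn⟩ := h τ hτ
    have hy : proj Φ ((quotientEndHom Φ (kernelSubgroup Φ I) τ).map (Rat.cast : ℚ → ℝ) *ᵥ x) ∈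
        kernelSubgroup Φ I :=
      (proj_mem_iff_exists_quotientMatrix_mulVec_eq Φ (kernelSubgroup Φ I) _).2
        ⟨n, by rw [Matrix.mulVec_mulVec, quotientMatrix_mul_quotientEndHom_map, ← Matrix.mulVec_mulVec, hn]⟩
    exact (proj_mem_kernelSubgroup_iff Φ I _).1 hy σ hσ
  · -- conversely every `σ ∈ I` sends `η(τ) x` into `ℤ^ι`, so `π(η(τ) x) ∈ H(I)` and `Q_I (η(τ) x) ∈ ℤ^ι`
    have hy : proj Φ ((quotientEndHom Φ (kernelSubgroup Φ I) τ).map (Rat.cast : ℚ → ℝ) *ᵥ x) ∈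
        kernelSubgroup Φ I :=
      (proj_mem_kernelSubgroup_iff Φ I _).2 fun σ hσ ↦ h σ hσ τ hτ
    obtain ⟨n, hn⟩ := (proj_mem_iff_exists_quotientMatrix_mulVec_eq Φ (kernelSubgroup Φ I) _).1 hy
    exact ⟨n, by rw [← hn, Matrix.mulVec_mulVec, Matrix.mulVec_mulVec, quotientMatrix_mul_quotientEndHom_map]⟩

/-- **LEMMA 1.4.4 (kernel form): `H_X(Iη(J)) = φ_I⁻¹(H_B(J))`** — the kernel of the composite
`φ_{B,J} ∘ φ_{A,I} : X → B → B/H_B(J)` is the kernel subgroup of the ideal `Iη(J)` of `End(X)`.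
[cite: Kieffer2024IsogenyGraphs, §1.4.1 Lemma 1.4.4, p. 44] -/
theorem kernelSubgroup_idealMulEta :
    kernelSubgroup Φ (idealMulEta Φ I J) =
      (kernelSubgroup (quotientByPeriod Φ (kernelSubgroup Φ I)) J).comap
        (mapMatrixHom Φ (quotientByPeriod Φ (kernelSubgroup Φ I)) (quotientMatrix Φ (kernelSubgroup Φ I))) := by
  ext t
  rw [← proj_lift Φ t, AddSubgroup.mem_comap, mapMatrixHom_apply, mapMatrix_proj,
    proj_mem_kernelSubgroup_idealMulEta_iff, proj_mulVec_quotientMatrix_mem_kernelSubgroup_iff]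

/-- `H(Iη(End B)) = φ_I⁻¹(0) = H(I)`. [cite: Kieffer2024IsogenyGraphs, §1.4.1 Lemma 1.4.4, p. 44] -/
theorem kernelSubgroup_idealMulEta_top : kernelSubgroup Φ (idealMulEta Φ I ⊤) = kernelSubgroup Φ I := by
  rw [kernelSubgroup_idealMulEta, kernelSubgroup_top, AddMonoidHom.comap_bot, ker_mapMatrixHom_quotientBy]

/-- **`φ_K⁻¹(K′) = Ker(φ_{K′} ∘ φ_K)`** for finite `K ≤ X`, `K′ ≤ X/K`: the preimage of `K′` under the quotient
isogeny is the kernel of the composite quotient isogeny `X → X/K → (X/K)/K′` (rational representation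
`Q_{K′} Q_K`). [cite: Kieffer2024IsogenyGraphs, §1.1.2 Prop. 1.1.11 and §1.4.1 Lemma 1.4.4, pp. 10, 44] -/
theorem comap_quotientBy_eq_ker (K : AddSubgroup (ComplexTorus Φ)) [Finite K]
    (K' : AddSubgroup (ComplexTorus (quotientByPeriod Φ K))) [Finite K'] :
    K'.comap (mapMatrixHom Φ (quotientByPeriod Φ K) (quotientMatrix Φ K)) =
      (mapMatrixHom Φ (quotientByPeriod (quotientByPeriod Φ K) K')
        (quotientMatrix (quotientByPeriod Φ K) K' * quotientMatrix Φ K)).ker := by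
  ext t
  rw [AddSubgroup.mem_comap, mapMatrixHom_apply, mem_ker_mapMatrixHom_iff,
    ← mapMatrix_mapMatrix (Φ' := quotientByPeriod Φ K),
    ← mem_ker_mapMatrixHom_iff (quotientByPeriod Φ K) _ (quotientMatrix (quotientByPeriod Φ K) K'),
    ker_mapMatrixHom_quotientBy]

/-- **The composite of two quotient isogenies `X → X/K → (X/K)/K′` is an isogeny** (rational representation
`Q_{K′} Q_K`). [cite: Kieffer2024IsogenyGraphs, §1.4.1 Lemma 1.4.4 ("the composite map `φ_{B,J} ∘ φ_{A,I}`"), p. 44] -/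
theorem isIsogeny_quotientMatrix_mul (K : AddSubgroup (ComplexTorus Φ)) [Finite K]
    (K' : AddSubgroup (ComplexTorus (quotientByPeriod Φ K))) [Finite K'] :
    IsIsogeny Φ (quotientByPeriod (quotientByPeriod Φ K) K') (quotientMatrix (quotientByPeriod Φ K) K' * quotientMatrix Φ K) :=
  IsIsogeny.mul Φ _ _ (isIsogeny_quotientBy (quotientByPeriod Φ K) K') (isIsogeny_quotientBy Φ K)

/-- **LEMMA 1.4.4: `H_X(Iη(J)) = Ker(φ_{B,J} ∘ φ_{A,I})`.** [cite: Kieffer2024IsogenyGraphs, §1.4.1 Lemma 1.4.4, p. 44] -/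
theorem kernelSubgroup_idealMulEta_eq_ker [Finite (kernelSubgroup (quotientByPeriod Φ (kernelSubgroup Φ I)) J)] :
    kernelSubgroup Φ (idealMulEta Φ I J) =
      (mapMatrixHom Φ (quotientByPeriod (quotientByPeriod Φ (kernelSubgroup Φ I))
          (kernelSubgroup (quotientByPeriod Φ (kernelSubgroup Φ I)) J))
        (quotientMatrix (quotientByPeriod Φ (kernelSubgroup Φ I))
            (kernelSubgroup (quotientByPeriod Φ (kernelSubgroup Φ I)) J) *
          quotientMatrix Φ (kernelSubgroup Φ I))).ker := by
  rw [kernelSubgroup_idealMulEta, comap_quotientBy_eq_ker]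

/-- `H(Iη(J))` is finite when `H_B(J)` is (the kernel of a composite of isogenies) — so `X/H(Iη(J))` exists.
[cite: Kieffer2024IsogenyGraphs, §1.4.1 Def. 1.4.1 ("it is a finite subgroup scheme") and Lemma 1.4.4, pp. 43–44] -/
instance finite_kernelSubgroup_idealMulEta
    [Finite (kernelSubgroup (quotientByPeriod Φ (kernelSubgroup Φ I)) J)] :
    Finite (kernelSubgroup Φ (idealMulEta Φ I J)) := by
  rw [kernelSubgroup_idealMulEta_eq_ker]
  exact (isIsogeny_quotientMatrix_mul Φ _ _).finite_ker

/-- **LEMMA 1.4.4. "the composite map `φ_{B,J} ∘ φ_{A,I}` is precisely `φ_{A,Iη(J)}`"** — at torus level, in the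
sense of Prop. 1.1.11 (the tree's `IsIsogeny.exists_unimodular_of_ker_eq`): the two isogenies
`φ_{A,Iη(J)} : X → X/H(Iη(J))` and `φ_{B,J} ∘ φ_{A,I} : X → B → B/H_B(J)` out of `X` have the same kernel, hence
differ by an isomorphism `ρ(C) : X/H(Iη(J)) ≅ B/H_B(J)` of complex tori UNDER `X` — `C ∈ GL_ι(ℤ)` with
`C · Q_{Iη(J)} = Q_J · Q_I`, `C⁻¹ · (Q_J Q_I) = Q_{Iη(J)}`, both with `ℂ`-linear analytic representations.
[cite: Kieffer2024IsogenyGraphs, §1.4.1 Lemma 1.4.4 (p. 44) and §1.1.2 Prop. 1.1.11 (p. 10)] -/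
theorem exists_unimodular_quotient_idealMulEta
    [Finite (kernelSubgroup (quotientByPeriod Φ (kernelSubgroup Φ I)) J)] :
    ∃ (C C' : Matrix ι ι ℤ),
      C * quotientMatrix Φ (kernelSubgroup Φ (idealMulEta Φ I J)) =
        quotientMatrix (quotientByPeriod Φ (kernelSubgroup Φ I))
            (kernelSubgroup (quotientByPeriod Φ (kernelSubgroup Φ I)) J) * quotientMatrix Φ (kernelSubgroup Φ I) ∧
      C' * (quotientMatrix (quotientByPeriod Φ (kernelSubgroup Φ I))
            (kernelSubgroup (quotientByPeriod Φ (kernelSubgroup Φ I)) J) * quotientMatrix Φ (kernelSubgroup Φ I)) =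
        quotientMatrix Φ (kernelSubgroup Φ (idealMulEta Φ I J)) ∧
      C' * C = 1 ∧ C * C' = 1 ∧
      (∃ g : E →L[ℂ] E, ∀ y, quotientByPeriod (quotientByPeriod Φ (kernelSubgroup Φ I))
          (kernelSubgroup (quotientByPeriod Φ (kernelSubgroup Φ I)) J) (C.map (Int.cast : ℤ → ℝ) *ᵥ y) =
        g (quotientByPeriod Φ (kernelSubgroup Φ (idealMulEta Φ I J)) y)) ∧
      ∃ g' : E →L[ℂ] E, ∀ y,
        quotientByPeriod Φ (kernelSubgroup Φ (idealMulEta Φ I J)) (C'.map (Int.cast : ℤ → ℝ) *ᵥ y) =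
          g' (quotientByPeriod (quotientByPeriod Φ (kernelSubgroup Φ I))
            (kernelSubgroup (quotientByPeriod Φ (kernelSubgroup Φ I)) J) y) :=
  (isIsogeny_quotientBy Φ (kernelSubgroup Φ (idealMulEta Φ I J))).exists_unimodular_of_ker_eq
    (isIsogeny_quotientMatrix_mul Φ _ _) (by rw [ker_mapMatrixHom_quotientBy, kernelSubgroup_idealMulEta_eq_ker])

/-- **LEMMA 1.4.4, isomorphism-class form: `X/H(Iη(J)) ≅ (X/H(I))/H_B(J)`** as complex tori.
[cite: Kieffer2024IsogenyGraphs, §1.4.1 Lemma 1.4.4, p. 44] -/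
theorem isIsomorphic_quotient_idealMulEta [Finite (kernelSubgroup (quotientByPeriod Φ (kernelSubgroup Φ I)) J)] :
    IsIsomorphic (quotientByPeriod Φ (kernelSubgroup Φ (idealMulEta Φ I J)))
      (quotientByPeriod (quotientByPeriod Φ (kernelSubgroup Φ I))
        (kernelSubgroup (quotientByPeriod Φ (kernelSubgroup Φ I)) J)) :=
  (isIsogeny_quotientBy Φ (kernelSubgroup Φ (idealMulEta Φ I J))).isIsomorphic_of_ker_eq
    (isIsogeny_quotientMatrix_mul Φ _ _) (by rw [ker_mapMatrixHom_quotientBy, kernelSubgroup_idealMulEta_eq_ker])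

end Lemma144

end ComplexTorus

end Literature.Geometry.Kaehler
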